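import Summits.BirchSwinnertonDyer.BirchSwinnertonDyer.Theorems.SignedLowerHalvesKobayashiLowerHalfLargeImageMuPartSqueeze
import HarnessLib

/-!
# Route `SignedLowerHalves`, crux 3 `KobayashiLowerHalfLargeImage` (item stmt-BirchSwinnertonDyer-19001):
# the GENERAL sign-blind squeeze — ANY lower bound `λ(ξ^{ε₁}) ≥ λ(L_p^{ε₁})` for ONE sign at ONE dual datum gives
# `char X^ε = (L_p^ε)` / Kobayashi's main conjecture for BOTH signs (large image; `p = 3` mod published facts, `p ≥ 5` mod B⁰)
# (cell `bsd-ssimc`, width seat `bsd-line-slh-p1-w6` gen 0; helper file `--supports 19001`; THEOREMS ONLY)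

HONEST FRAMING.  The crux is OPEN; BSD is not proved by any of this.  This file abstracts the rank squeeze of
`…LargeImageMuPartSqueeze.lean` (where the lower bound `λ(ξ^{ε₁}) ≥ rank E(ℚ) ≥ λ(L_p^{ε₁})` came from the control theorem): with
the sign-blind defect `δ` of unit content, `λ(ξ^ε) + λ(δ) = λ(L_p^ε)` for both signs, so ANY inequality `λ(L_p^{ε₁}) ≤ λ(ξ^{ε₁})` for
ONE sign and ONE dual datum forces `λ(δ) = 0`, `δ ∈ Λˣ`, and `char X^ε = (L_p^ε)` for EVERY sign and EVERY datum at the frame.  Other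
lower bounds than the rank plug in here — e.g. the λ = 2 stratum road of K1G17 §4 (a) / width seat w2 g6 (`p ∣ Tam(E)` ⟹ `X^ε ≠ 0`
⟹ `λ(X^ε) = 2` by parity and «no finite submodule»), or any future algebraic lower bound on `λ(X^ε)`.

* `charIdeal_eq_span_forall_of_lam_le_lam_charGen_of_muFloor` — per frame: one datum `D₁` of sign `ε₁` with generator `ξ₁` and
  `λ(L_p^{ε₁}) ≤ λ(ξ₁)` ⟹ `D.charIdeal = (L_p^ε)` for every sign `ε` and every datum `D` at that frame (μ-floor as a hypothesis).
* `kobayashiMainConjecture_forall_of_lamLowerBound_of_muFloor` / `…_three` / `…_of_teichSpanGenAll` — the main conjecture for both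
  signs from a frame-wise λ-lower-bound certificate `hcert` (at every cyclotomic frame some sign/datum/generator with `λ(L) ≤ λ(ξ)`).
CONDITIONAL on the PUBLISHED facts `h12`, `h41`, `h5`, `h3`, `hJ` (+ the μ-floor supplier).  CALIBRATION / SUPPORT ONLY (pen rule D34-4 (3)).

References: [Kobayashi2003] Conjecture (p. 2), Thm. 1.2, Thm. 4.1, proof of Thm. 7.4 (p. 13); [GreenbergVatsal2000] p. 4, §3 Rem. 3.4;
[PollackWeston2011] Rem. 4.2; [Vaserstein1972SL2] Theorem.
-/

-- D-0017: single-problem summit, the namespace repeats the problem name by design.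
set_option linter.dupNamespace false
set_option autoImplicit false

noncomputable section

open scoped Classical MatrixGroups ModularForm

open CongruenceSubgroup WeierstrassCurve Literature.NumberTheory.EllipticCurves
  Literature.NumberTheory.EllipticCurves.ModularForms
  Literature.NumberTheory.EllipticCurves.Kobayashi2003 Literature.NumberTheory.EllipticCurves.GreenbergVatsal2000
  Literature.NumberTheory.EllipticCurves.Rank1Residual ZpExtension
  Summit.BirchSwinnertonDyer.Rank1Residual.Supersingular

namespace Summit.BirchSwinnertonDyer.BirchSwinnertonDyer.Theorems.LargeImageMuPartSqueezeGeneral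

open Summit.BirchSwinnertonDyer.Rank1Residual.X1.MuLambda (mu lam)
open Summit.BirchSwinnertonDyer.BirchSwinnertonDyer.Cruxes.AnalyticMuZeroX9.TeichSpan (TeichSpanGenAll)
open Summit.BirchSwinnertonDyer.BirchSwinnertonDyer.Theorems.LargeImageMuPart
  (exists_signBlindDefect_hasUnitContent_of_muFloor mu_eq_and_lam_add_eq_of_span_mul_eq_span
    mu_eq_and_lam_eq_of_span_eq span_eq_iff_lam_eq_of_span_mul_eq_span)

section General

variable {p : ℕ} [Fact p.Prime] {W : WeierstrassCurve ℚ} [W.IsElliptic] [W.IsGloballyMinimal]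

/-- **Per frame: ONE λ-inequality for ONE sign ⟹ `char X^ε = (L_p^ε)` for EVERY sign and datum.**  GRANTED `h12`, `h41`, `h5`, `h3`,
`hJ` and the μ-floor `hfloor` at `(W, p)`; `p` odd good, `a_p = 0`, `ρ̄` onto; a cyclotomic frame `(κ, γ)`, the newform `f`, a Pollack pair.
If some dual datum `D₁` of some sign `ε₁` has a generator `ξ₁` of `char X^{ε₁}` with `λ(kobayashiL ε₁ L⁺ L⁻) ≤ λ(ξ₁)`, then for every sign
`ε` and every datum `D` at the frame, `D.charIdeal = (kobayashiL ε L⁺ L⁻)`.  (`λ(ξ₁) + λ(δ) = λ(L^{ε₁})` forces `λ(δ) = 0`.)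
[cite: Kobayashi2003, proof of Thm. 7.4 (p. 13), Thm. 4.1] [cite: GreenbergVatsal2000, p. 4] -/
theorem charIdeal_eq_span_forall_of_lam_le_lam_charGen_of_muFloor
    (h12 : Kobayashi2003.thm12_signedSelmerDual_finite_torsion)
    (h41 : Kobayashi2003.thm41_signedCharIdeal_divisibility)
    (h5 : realPeriodRat_eq_unit_mul_plusPeriod) (h3 : realPeriodRat_eq_unit_mul_plusPeriod_three)
    (hJ : Kobayashi2003.thm62_63_73_signedColemanKato_zetaJoint)
    (hfloor : ∃ ε₀ : ℤˣ, ∀ [NeZero (W.conductorNorm ℤ)] (f : CuspForm (Gamma0 (W.conductorNorm ℤ)) 2),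
      IsNewformOf W f → ∀ Lplus Lminus : IwasawaAlgebra p, IsPollackPair f p Lplus Lminus →
        HasUnitContent (kobayashiL ε₀ Lplus Lminus))
    (hp2 : p ≠ 2) (hgood : W.HasGoodReductionAtPrime p) (hap : W.frobeniusTrace p = 0) (hs : Surj W p)
    {κ : ZpExtension ℚ p} {γ : Field.absoluteGaloisGroup ℚ} (hκ : κ.IsCyclotomic)
    (hγ : κ.IsTopGenerator γ) (hγc : IsCyclotomicVariable p γ) [NeZero (W.conductorNorm ℤ)]
    {f : CuspForm (Gamma0 (W.conductorNorm ℤ)) 2} (hf : IsNewformOf W f)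
    {Lplus Lminus : IwasawaAlgebra p} (hPP : IsPollackPair f p Lplus Lminus)
    {ε₁ : ℤˣ} (D₁ : Kobayashi2003.SignedSelmerDualData W κ γ ε₁) {ξ₁ : IwasawaAlgebra p}
    (hξ₁ : D₁.charIdeal = Ideal.span {ξ₁}) (hle : lam (kobayashiL ε₁ Lplus Lminus) ≤ lam ξ₁) :
    ∀ (ε : ℤˣ) (D : Kobayashi2003.SignedSelmerDualData W κ γ ε),
      D.charIdeal = Ideal.span {kobayashiL ε Lplus Lminus} := by
  obtain ⟨δ, hδu, hδ⟩ :=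
    exists_signBlindDefect_hasUnitContent_of_muFloor h12 h41 h5 h3 hJ hfloor hp2 hgood hap hs hκ hγ hγc hf hPP
  have hL0 : ∀ s : ℤˣ, kobayashiL s Lplus Lminus ≠ 0 := by
    intro s
    rcases Int.units_eq_one_or s with rfl | rfl
    · simpa [kobayashiL] using hPP.2.1
    · have hne : (-1 : ℤˣ) ≠ 1 := by decide
      simpa [kobayashiL, hne] using hPP.1
  -- `λ(δ) = 0` from the certificate sign
  obtain ⟨ξ₁', hξ₁', hspan₁⟩ := hδ ε₁ D₁
  have hξ₁'0 : ξ₁' ≠ 0 := by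
    intro h0
    rw [h0, zero_mul, Ideal.span_singleton_eq_span_singleton] at hspan₁
    exact hL0 ε₁ (zero_dvd_iff.mp hspan₁.dvd)
  have hsame : Ideal.span ({ξ₁'} : Set (IwasawaAlgebra p)) = Ideal.span {ξ₁} := by rw [← hξ₁', hξ₁]
  obtain ⟨-, hlamξ⟩ := mu_eq_and_lam_eq_of_span_eq hξ₁'0 hsame
  obtain ⟨-, hlam₁⟩ := mu_eq_and_lam_add_eq_of_span_mul_eq_span (hL0 ε₁) hδu hspan₁
  obtain ⟨-, h2⟩ := span_eq_iff_lam_eq_of_span_mul_eq_span (hL0 ε₁) hδu hspan₁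
  have hlamδ : lam δ = 0 := by
    rw [hlamξ] at hlam₁
    omega
  -- every sign, every datum
  intro ε D
  obtain ⟨ξ, hξ, hspan⟩ := hδ ε D
  obtain ⟨h1, h2'⟩ := span_eq_iff_lam_eq_of_span_mul_eq_span (hL0 ε) hδu hspan
  rw [hξ]
  exact h1.mpr (h2'.mpr hlamδ)

/-- **Kobayashi's main conjecture for BOTH signs from a frame-wise λ-lower-bound certificate** (μ-floor as a hypothesis): at every
cyclotomic frame, SOME sign `ε₁`, SOME datum `D₁` and SOME generator `ξ₁` with `λ(L_p^{ε₁}) ≤ λ(ξ₁)`.  GRANTED `h12`, `h41`, `h5`, `h3`,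
`hJ`; `p` odd good, `a_p = 0`, `ρ̄` onto. [cite: Kobayashi2003, Conjecture (p. 2), Thm. 1.2, Thm. 4.1] [cite: GreenbergVatsal2000, §3 Remark 3.4] -/
theorem kobayashiMainConjecture_forall_of_lamLowerBound_of_muFloor
    (h12 : Kobayashi2003.thm12_signedSelmerDual_finite_torsion)
    (h41 : Kobayashi2003.thm41_signedCharIdeal_divisibility)
    (h5 : realPeriodRat_eq_unit_mul_plusPeriod) (h3 : realPeriodRat_eq_unit_mul_plusPeriod_three)
    (hJ : Kobayashi2003.thm62_63_73_signedColemanKato_zetaJoint)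
    (hfloor : ∃ ε₀ : ℤˣ, ∀ [NeZero (W.conductorNorm ℤ)] (f : CuspForm (Gamma0 (W.conductorNorm ℤ)) 2),
      IsNewformOf W f → ∀ Lplus Lminus : IwasawaAlgebra p, IsPollackPair f p Lplus Lminus →
        HasUnitContent (kobayashiL ε₀ Lplus Lminus))
    (hp2 : p ≠ 2) (hgood : W.HasGoodReductionAtPrime p) (hap : W.frobeniusTrace p = 0) (hs : Surj W p)
    (hcert : ∀ (κ : ZpExtension ℚ p) (γ : Field.absoluteGaloisGroup ℚ),
      κ.IsCyclotomic → κ.IsTopGenerator γ → IsCyclotomicVariable p γ →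
      ∀ [NeZero (W.conductorNorm ℤ)] (f : CuspForm (Gamma0 (W.conductorNorm ℤ)) 2), IsNewformOf W f →
      ∀ (Lplus Lminus : IwasawaAlgebra p), IsPollackPair f p Lplus Lminus →
      ∃ (ε₁ : ℤˣ) (D₁ : Kobayashi2003.SignedSelmerDualData W κ γ ε₁) (ξ₁ : IwasawaAlgebra p),
        D₁.charIdeal = Ideal.span {ξ₁} ∧ lam (kobayashiL ε₁ Lplus Lminus) ≤ lam ξ₁) :
    ∀ ε : ℤˣ, KobayashiMainConjecture W p ε := by
  intro ε κ γ hκ hγ hγc _ f hf ϖ hϖ Lplus Lminus hPP D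
  haveI : Module.Finite (IwasawaAlgebra p) D.X := h12.moduleFinite hp2 hgood hap hκ hγ D
  have hX : Module.IsTorsion (IwasawaAlgebra p) D.X := h12.isTorsion hp2 hgood hap hκ hγ D
  refine ⟨hX, ?_⟩
  obtain ⟨ε₁, D₁, ξ₁, hξ₁, hle⟩ := hcert κ γ hκ hγ hγc f hf Lplus Lminus hPP
  have hchar : D.charIdeal = Ideal.span {kobayashiL ε Lplus Lminus} :=
    charIdeal_eq_span_forall_of_lam_le_lam_charGen_of_muFloor h12 h41 h5 h3 hJ hfloor hp2 hgood hap hs hκ hγ hγc hf hPP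
      D₁ hξ₁ hle ε D
  -- the period ratio `ϖ` is a `p`-adic unit
  have hirr : W.HasIrreducibleModPGaloisRep p :=
    hasIrreducibleModPGaloisRep_of_dvd_frobeniusTrace W p hp2
      (W.not_dvd_minimalDiscriminantInt_of_hasGoodReductionAtPrime' p hgood) (by rw [hap]; exact dvd_zero _)
  have hvϖ : padicValRat p ϖ = 0 := padicValRat_periodRatio_eq_zero h5 h3 W p hp2 hgood hirr f hf ϖ hϖ
  have hϖ0 : ϖ ≠ 0 := by
    intro h0
    rw [h0, Rat.cast_zero, zero_mul] at hϖ
    exact (IsNewform0.plusPeriod_pos_holds hf.1 hf.coeffField_eq_bot).ne' hϖ.symm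
  obtain ⟨u, hu⟩ := exists_units_coe_eq_ratCast hϖ0 hvϖ
  obtain ⟨hspan', hι⟩ := span_C_units_mul_eq u (kobayashiL ε Lplus Lminus)
  refine ⟨PowerSeries.C (u : ℤ_[p]) * kobayashiL ε Lplus Lminus, ?_, ?_⟩
  · rw [hchar, hspan']
  · rw [hι, hu]

/-- **The general squeeze at `p = 3`, PUBLISHED facts only.** [cite: Kobayashi2003, Conjecture (p. 2), Thm. 4.1] [cite: Vaserstein1972SL2, Theorem] -/
theorem kobayashiMainConjecture_forall_of_lamLowerBound_three
    (h12 : Kobayashi2003.thm12_signedSelmerDual_finite_torsion)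
    (h41 : Kobayashi2003.thm41_signedCharIdeal_divisibility)
    (h5 : realPeriodRat_eq_unit_mul_plusPeriod) (h3 : realPeriodRat_eq_unit_mul_plusPeriod_three)
    (hJ : Kobayashi2003.thm62_63_73_signedColemanKato_zetaJoint)
    (hp3 : p = 3) (hgood : W.HasGoodReductionAtPrime p) (hap : W.frobeniusTrace p = 0) (hs : Surj W p)
    (hcert : ∀ (κ : ZpExtension ℚ p) (γ : Field.absoluteGaloisGroup ℚ),
      κ.IsCyclotomic → κ.IsTopGenerator γ → IsCyclotomicVariable p γ →
      ∀ [NeZero (W.conductorNorm ℤ)] (f : CuspForm (Gamma0 (W.conductorNorm ℤ)) 2), IsNewformOf W f →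
      ∀ (Lplus Lminus : IwasawaAlgebra p), IsPollackPair f p Lplus Lminus →
      ∃ (ε₁ : ℤˣ) (D₁ : Kobayashi2003.SignedSelmerDualData W κ γ ε₁) (ξ₁ : IwasawaAlgebra p),
        D₁.charIdeal = Ideal.span {ξ₁} ∧ lam (kobayashiL ε₁ Lplus Lminus) ≤ lam ξ₁) :
    ∀ ε : ℤˣ, KobayashiMainConjecture W p ε :=
  kobayashiMainConjecture_forall_of_lamLowerBound_of_muFloor h12 h41 h5 h3 hJ
    (LargeImageMuFloor.signedMuFloor_three (W := W) p hp3 hgood hap) (by subst hp3; decide) hgood hap hs hcert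

/-- **The general squeeze at an odd prime, B⁰ only at `p ≥ 5`.** [cite: Kobayashi2003, Conjecture (p. 2), Thm. 4.1] [cite: PollackWeston2011, Rem. 4.2] -/
theorem kobayashiMainConjecture_forall_of_lamLowerBound_of_teichSpanGenAll
    (h12 : Kobayashi2003.thm12_signedSelmerDual_finite_torsion)
    (h41 : Kobayashi2003.thm41_signedCharIdeal_divisibility)
    (h5 : realPeriodRat_eq_unit_mul_plusPeriod) (h3 : realPeriodRat_eq_unit_mul_plusPeriod_three)
    (hJ : Kobayashi2003.thm62_63_73_signedColemanKato_zetaJoint) (hB : TeichSpanGenAll)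
    (hp2 : p ≠ 2) (hgood : W.HasGoodReductionAtPrime p) (hap : W.frobeniusTrace p = 0) (hs : Surj W p)
    (hcert : ∀ (κ : ZpExtension ℚ p) (γ : Field.absoluteGaloisGroup ℚ),
      κ.IsCyclotomic → κ.IsTopGenerator γ → IsCyclotomicVariable p γ →
      ∀ [NeZero (W.conductorNorm ℤ)] (f : CuspForm (Gamma0 (W.conductorNorm ℤ)) 2), IsNewformOf W f →
      ∀ (Lplus Lminus : IwasawaAlgebra p), IsPollackPair f p Lplus Lminus →
      ∃ (ε₁ : ℤˣ) (D₁ : Kobayashi2003.SignedSelmerDualData W κ γ ε₁) (ξ₁ : IwasawaAlgebra p),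
        D₁.charIdeal = Ideal.span {ξ₁} ∧ lam (kobayashiL ε₁ Lplus Lminus) ≤ lam ξ₁) :
    ∀ ε : ℤˣ, KobayashiMainConjecture W p ε :=
  kobayashiMainConjecture_forall_of_lamLowerBound_of_muFloor h12 h41 h5 h3 hJ
    (LargeImageMuFloor.signedMuFloor_of_teichSpanGenAll (W := W) hB hp2 hgood hap) hp2 hgood hap hs hcert

end General

end Summit.BirchSwinnertonDyer.BirchSwinnertonDyer.Theorems.LargeImageMuPartSqueezeGeneral

end
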